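import Summits.BirchSwinnertonDyer.BirchSwinnertonDyer.Theorems.KatoDescentPotSupersingularFineSelmerControl
import Summits.BirchSwinnertonDyer.BirchSwinnertonDyer.Theorems.KatoDescentPotSupersingularTowerTorsionVanishing
import Literature.NumberTheory.EllipticCurves.TwoVariableAnticyclotomicControl
import HarnessLib

/-!
# Fine control along a `ℤ_p`-tower WITHOUT a finite layer: (i) a class of `H¹(K, E[p^∞])` vanishing on
# `Gal(K̄/K_∞) ⊓ D` vanishes on `D` when `E[p^∞]^{Gal(K̄/K_∞) ⊓ D} = 0`; (ii) `H¹(K, E[p^∞]) → H¹(K_∞, E[p^∞])` is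
# INJECTIVE when `E(K_∞)[p^∞] = 0`; (iii) over `ℚ` both hypotheses hold at the place above `p` as soon as
# `W(ℚ_p)[p] = 0` (p657752) — the two injectivity bricks of the EXACT fine control count `#Sel₀(ℚ_∞)^Γ = #Sel_str(ℚ)`
# behind clause (c2′) of the held core package 27962 on the tame rows (route-free helper, crux M = stmt-BirchSwinnertonDyer-19196)

Seat `bsd-potss-rkm` g26 (prover, cell `bsd-potss`), `--supports stmt-BirchSwinnertonDyer-19196 --as helper`; closes nothing.
HONEST FRAMING: BSD is not proved by any of this; nothing is booked; theorems only (no definition, no named fact, no `sorry`).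

## What and why

Memo FINDING-19196-rkm-g26 §3b: on the rows of crux M with `W(ℚ_p)[p] = 0` (all (t′) rows at `p ≥ 11`) Kato's `𝐇²_Γ(T_pW)` IS
the dual fine Selmer group `X₀(W/ℚ_∞)`, and the count clause (c2′) `#(𝐇²/X𝐇²)·#W(ℚ)[p^∞] = #Sel_str(ℚ,W[p^∞])·#W(ℚ_p)[p^∞]` of the
held package `Kato2004.exists_memberHullZetaCoreInputs` becomes the EXACT FINE CONTROL count `#Sel₀(ℚ_∞, W[p^∞])^Γ =
#Sel_str(ℚ, W[p^∞])` (`t_p = t₀ = 0`).  Its proof has three bricks: (a) INJECTIVITY of `H¹(ℚ,W[p^∞]) → H¹(ℚ_∞,W[p^∞])`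
(inflation–restriction with `W(ℚ_∞)[p^∞] = 0`), (b) the LOCAL condition at `p`: «trivial on `Gal(ℚ̄/ℚ_∞) ⊓ D_p`» ⟹ «trivial on
`D_p`» (inflation–restriction on `D_p` with `W(ℚ_{p,∞})[p^∞] = 0`), (c) surjectivity onto `Γ`-invariants (Greenberg L.3.2, tree
`ZpExtension.mem_range_resOfLe_of_conjH1_eq`) + the place-by-place identification at `ℓ ≠ p` and the count.  This file lands (a) and
(b), for EVERY number field `K`, curve `W/K`, `ℤ_p`-extension `κ` and subgroup `D` (the tree's `…FineSelmerControl` §4 proves (b)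
with a FINITE layer `Gal(K̄/K_m) ⊓ D` in place of `Gal(K̄/K_∞) ⊓ D`; the cocycle computation is the same, the fixed-point input is
now `E[p^∞]^{Gal(K̄/K_∞) ⊓ D} = 0`), and their discharge over `ℚ` from `W(ℚ_p)[p] = 0` (`TowerTorsionVanishing`, p657752):

* §1 `resOfLe_inf_eq_zero_of_resOfLe_kerSubgroup_inf_eq_zero` — (b) generic.
* §2 `fixedPoints_kerSubgroup_eq_bot_of_noPTorsionPadic` (`W(ℚ_∞)[p^∞] = 0` for every `ℤ_p`-extension of `ℚ` when
  `W(ℚ_p)[p] = 0` — the VANISHING form of Ribet's finiteness on these rows), `resOfLe_kerSubgroup_injective_of_noPTorsionPadic` — (a)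
  over `ℚ`; `resOfLe_inf_decomp_eq_zero_of_resOfLe_kerSubgroup_inf_decomp_eq_zero` — (b) over `ℚ` at the place above `p`;
  `…_of_addv_of_eleven_le` forms (every additive `p ≥ 11`, no local hypothesis).

References: R. Greenberg, LNM 1716 (1999), §3 Lemma 3.1–3.2 and Prop. 3.8 (pp. 86–96) [GreenbergLNM1716]; J.-P. Serre, *Galois
Cohomology*, I.§2.6 [SerreGaloisCohomology1997]; K. Kato, Astérisque 295 (2004), (14.9.3) (p. 240), (14.14.2) (p. 243)
[Kato2004Asterisque]; B. Mazur, Publ. IHÉS 47 (1977), III §5 Step 1 [Mazur1977].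
-/

-- the summit and its single problem are both named `BirchSwinnertonDyer` (registry layout D-0017)
set_option linter.dupNamespace false
set_option autoImplicit false

noncomputable section

open scoped Classical NumberField
open Function Field NumberField IsDedekindDomain
open Literature.NumberTheory.EllipticCurves Literature.NumberTheory.EllipticCurves.GreenbergSelmer
open Literature.NumberTheory.GaloisRepresentations
open Literature.NumberTheory.EllipticCurves.Rank1Residual
open Summit.BirchSwinnertonDyer.Rank1Residual

universe u

namespace Summit.BirchSwinnertonDyer.BirchSwinnertonDyer.Theorems.TowerFineControl

/-! ## §1 (b) generic: vanishing on `Gal(K̄/K_∞) ⊓ D` ⟹ vanishing on `D`, when `E[p^∞]^{Gal(K̄/K_∞) ⊓ D} = 0` -/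

section Generic

variable {K : Type u} [Field K] (W : WeierstrassCurve K) {p : ℕ} [Fact p.Prime] (κ : ZpExtension K p)

/-- **A class of `H¹(K, E[p^∞])` that vanishes on `Gal(K̄/K_∞) ⊓ D` vanishes on `D`**, provided `E[p^∞]` has no non-zero
point fixed by `Gal(K̄/K_∞) ⊓ D` (inflation–restriction on `D ⊳ Gal(K̄/K_∞) ⊓ D`: with a cocycle `φ` principal on
`N = Gal(K̄/K_∞) ⊓ D`, `φ = δT` there, the cocycle identities at `τ d = d (d⁻¹ τ d)` give `τ • u_d = u_d` for
`u_d = φ(d) − (dT − T)`, so `u_d = 0`).  The infinite-level twin of `FineSelmerControl.resOfLe_layerZero_inf_eq_zero`.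
[cite: SerreGaloisCohomology1997, I.§2.6 (inflation–restriction)] [cite: GreenbergLNM1716, §3 Lemma 3.1 and p. 96] -/
theorem resOfLe_inf_eq_zero_of_resOfLe_kerSubgroup_inf_eq_zero (D : Subgroup (absoluteGaloisGroup K))
    (hfix : ∀ x : W.geomPrimaryTorsion p, (∀ τ ∈ κ.kerSubgroup ⊓ D, τ • x = x) → x = 0)
    {y : W.subgroupH1 p (κ.layerSubgroup 0)}
    (hy : W.resOfLe p (inf_le_left.trans (κ.kerSubgroup_le_layerSubgroup 0) :
      κ.kerSubgroup ⊓ D ≤ κ.layerSubgroup 0) y = 0) :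
    W.resOfLe p (inf_le_left : κ.layerSubgroup 0 ⊓ D ≤ κ.layerSubgroup 0) y = 0 := by
  set N : Subgroup (absoluteGaloisGroup K) := κ.kerSubgroup ⊓ D with hN
  have hNle : N ≤ κ.layerSubgroup 0 := inf_le_left.trans (κ.kerSubgroup_le_layerSubgroup 0)
  obtain ⟨φ, rfl⟩ := oneCocycleClass_surjective _ y
  obtain ⟨T, hT⟩ := FineSelmerLeSelmer.exists_principal_of_resH1Hom_oneCocycleClass_eq_zero
    (subgroupInclusion hNle) (AddMonoidHom.id (W.geomPrimaryTorsion p)) (fun _ _ ↦ rfl)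
    Function.bijective_id φ hy
  refine FineSelmerLeSelmer.resH1Hom_oneCocycleClass_eq_zero_of_principal
    (subgroupInclusion (inf_le_left : κ.layerSubgroup 0 ⊓ D ≤ κ.layerSubgroup 0))
    (AddMonoidHom.id (W.geomPrimaryTorsion p)) (fun _ _ ↦ rfl) φ (x := T) fun l ↦ ?_
  -- `l = d ∈ D`; the element `u = φ(d) − (d T − T)` is fixed by `N`
  obtain ⟨hd0, hdD⟩ := Subgroup.mem_inf.1 l.2
  set gd : κ.layerSubgroup 0 := ⟨(l : absoluteGaloisGroup K), hd0⟩ with hgd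
  have hgd' : subgroupInclusion (inf_le_left : κ.layerSubgroup 0 ⊓ D ≤ κ.layerSubgroup 0) l = gd :=
    Subtype.ext rfl
  rw [hgd']
  have hu : ∀ τ ∈ N, τ • (φ.1 gd - ((l : absoluteGaloisGroup K) • T - T)) =
      φ.1 gd - ((l : absoluteGaloisGroup K) • T - T) := by
    intro τ hτ
    set gτ : κ.layerSubgroup 0 := ⟨τ, hNle hτ⟩ with hgτ
    have hτ'N : (l : absoluteGaloisGroup K)⁻¹ * τ * l ∈ N := by
      obtain ⟨hτm, hτD⟩ := Subgroup.mem_inf.1 hτ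
      refine Subgroup.mem_inf.2 ⟨?_, D.mul_mem (D.mul_mem (D.inv_mem hdD) hτD) hdD⟩
      have h := (inferInstance : κ.kerSubgroup.Normal).conj_mem τ hτm (l : absoluteGaloisGroup K)⁻¹
      rwa [inv_inv] at h
    set gτ' : κ.layerSubgroup 0 := ⟨(l : absoluteGaloisGroup K)⁻¹ * τ * l, hNle hτ'N⟩ with hgτ'
    have hprod : gτ * gd = gd * gτ' := Subtype.ext (by
      change τ * (l : absoluteGaloisGroup K) = l * ((l : absoluteGaloisGroup K)⁻¹ * τ * l)
      group)
    have h1 : φ.1 (gτ * gd) = φ.1 gτ + τ • φ.1 gd := φ.2 gτ gd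
    have h2 : φ.1 (gd * gτ') = φ.1 gd + (l : absoluteGaloisGroup K) • φ.1 gτ' := φ.2 gd gτ'
    have e1 : φ.1 gτ = τ • T - T := hT ⟨τ, hτ⟩
    have e2 : φ.1 gτ' = ((l : absoluteGaloisGroup K)⁻¹ * τ * l) • T - T := hT ⟨_, hτ'N⟩
    have e3 : (l : absoluteGaloisGroup K) • (((l : absoluteGaloisGroup K)⁻¹ * τ * l) • T) =
        τ • ((l : absoluteGaloisGroup K) • T) := by
      rw [smul_smul, smul_smul, show (l : absoluteGaloisGroup K) * ((l : absoluteGaloisGroup K)⁻¹ * τ * l)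
        = τ * l by group]
    rw [hprod, h2, e1, e2, smul_sub, e3] at h1
    have h3 : τ • φ.1 gd = φ.1 gd + (τ • ((l : absoluteGaloisGroup K) • T) - (l : absoluteGaloisGroup K) • T)
        - (τ • T - T) := by
      rw [h1]; abel
    rw [smul_sub, smul_sub, h3]
    abel
  have hu0 : φ.1 gd - ((l : absoluteGaloisGroup K) • T - T) = 0 := hfix _ hu
  rw [sub_eq_zero] at hu0
  exact hu0

/-- **(a) generic: `H¹(H, E[p^∞]) → H¹(K_∞, E[p^∞])` is INJECTIVE for every `H ≥ Gal(K̄/K_∞)` when `E(K_∞)[p^∞] = 0`**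
(inflation–restriction; the kernel is `H¹(H/Gal(K̄/K_∞), E(K_∞)[p^∞])`, tree `resOfLe_injective_of_forall_fixed_eq_zero`).
[cite: GreenbergLNM1716, §3 Lemma 3.1 (p. 86)] [cite: SerreGaloisCohomology1997, I.§2.6] -/
theorem resOfLe_kerSubgroup_injective_of_fixedPoints_eq_bot {H : Subgroup (absoluteGaloisGroup K)}
    (hle : κ.kerSubgroup ≤ H) (hfix : FixedPoints.addSubgroup κ.kerSubgroup (W.geomPrimaryTorsion p) = ⊥) :
    Injective (W.resOfLe p hle) := by
  refine resOfLe_injective_of_forall_fixed_eq_zero hle fun m hm ↦ ?_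
  have hmem : m ∈ FixedPoints.addSubgroup κ.kerSubgroup (W.geomPrimaryTorsion p) :=
    (FixedPoints.mem_addSubgroup _ _ m).mpr fun g ↦ hm g g.2
  rw [hfix] at hmem
  exact (AddSubgroup.mem_bot).mp hmem

end Generic

/-! ## §2 Over `ℚ` from `W(ℚ_p)[p] = 0` -/

section Rat

variable (W : WeierstrassCurve ℚ) [W.IsElliptic] (p : ℕ) [Fact p.Prime] (κ : ZpExtension ℚ p)

/-- **`W(ℚ_p)[p] = 0 ⟹ W(ℚ_∞)[p^∞] = 0` for EVERY `ℤ_p`-extension `ℚ_∞ = ℚ̄^{ker κ}` of `ℚ`** (`(W(ℚ̄)[p^∞])^{ker κ} = ⊥`: a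
`ker κ`-fixed point is fixed by `ker κ ⊓ D_v`, and those fixed points vanish by `TowerTorsionVanishing`).  The VANISHING form — on
these rows — of the global finiteness of `E(ℚ_∞)[p^∞]` (Ribet 1981 / Imai 1975); no irreducibility hypothesis.
[cite: GreenbergLNM1716, §3 Lemma 3.1 (p. 86) and proof of Prop. 4.8] -/
theorem fixedPoints_kerSubgroup_eq_bot_of_noPTorsionPadic (v : HeightOneSpectrum (𝓞 ℚ))
    (hv : ((Rat.HeightOneSpectrum.primesEquiv v : Nat.Primes) : ℕ) = p)
    (h4 : ∀ R : (W.baseChange ℚ_[p]).toAffine.Point, p • R = 0 → R = 0) :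
    FixedPoints.addSubgroup κ.kerSubgroup (W.geomPrimaryTorsion p) = ⊥ := by
  have h := TowerTorsionVanishing.fixedPoints_kerSubgroup_inf_decomp_eq_bot_of_noPTorsionPadic W p κ v hv h4
  rw [eq_bot_iff] at h ⊢
  intro m hm
  exact h ((FixedPoints.mem_addSubgroup _ _ m).mpr fun g ↦
    (FixedPoints.mem_addSubgroup _ _ m).mp hm ⟨g.1, (Subgroup.mem_inf.mp g.2).1⟩)

/-- **(a) over `ℚ`: `H¹(H, W[p^∞]) → H¹(ℚ_∞, W[p^∞])` is INJECTIVE for every `H ≥ Gal(ℚ̄/ℚ_∞)` (in particular from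
`H¹(ℚ, W[p^∞])`, `H = layer 0`) when `W(ℚ_p)[p] = 0`** — the restriction step of fine control, with NO irreducibility and no
reduction hypothesis beyond the local one. [cite: GreenbergLNM1716, §3 Lemma 3.1 (p. 86)] -/
theorem resOfLe_kerSubgroup_injective_of_noPTorsionPadic {H : Subgroup (absoluteGaloisGroup ℚ)}
    (hle : κ.kerSubgroup ≤ H) (v : HeightOneSpectrum (𝓞 ℚ))
    (hv : ((Rat.HeightOneSpectrum.primesEquiv v : Nat.Primes) : ℕ) = p)
    (h4 : ∀ R : (W.baseChange ℚ_[p]).toAffine.Point, p • R = 0 → R = 0) :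
    Injective (W.resOfLe p hle) :=
  resOfLe_kerSubgroup_injective_of_fixedPoints_eq_bot W κ hle
    (fixedPoints_kerSubgroup_eq_bot_of_noPTorsionPadic W p κ v hv h4)

/-- **(b) over `ℚ` at the place above `p`: a class of `H¹(ℚ, W[p^∞])` vanishing on `Gal(ℚ̄/ℚ_∞) ⊓ D_v` vanishes on `D_v`**
when `W(ℚ_p)[p] = 0` — over `ℚ_∞` the fine/strict local condition at `𝔭 ∣ p` pulls back to Kato's STRICT condition `loc_p = 0`
at level `0`. [cite: GreenbergLNM1716, §3 p. 96 (Prop. 3.8)] [cite: Kato2004Asterisque, (14.9.3) (p. 240)] -/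
theorem resOfLe_inf_decomp_eq_zero_of_resOfLe_kerSubgroup_inf_decomp_eq_zero (v : HeightOneSpectrum (𝓞 ℚ))
    (hv : ((Rat.HeightOneSpectrum.primesEquiv v : Nat.Primes) : ℕ) = p)
    (h4 : ∀ R : (W.baseChange ℚ_[p]).toAffine.Point, p • R = 0 → R = 0)
    {y : W.subgroupH1 p (κ.layerSubgroup 0)}
    (hy : W.resOfLe p (inf_le_left.trans (κ.kerSubgroup_le_layerSubgroup 0) :
      κ.kerSubgroup ⊓ decomp v ≤ κ.layerSubgroup 0) y = 0) :
    W.resOfLe p (inf_le_left : κ.layerSubgroup 0 ⊓ decomp v ≤ κ.layerSubgroup 0) y = 0 := by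
  refine resOfLe_inf_eq_zero_of_resOfLe_kerSubgroup_inf_eq_zero W κ (decomp v) (fun x hx ↦ ?_) hy
  have h := TowerTorsionVanishing.fixedPoints_kerSubgroup_inf_decomp_eq_bot_of_noPTorsionPadic W p κ v hv h4
  have hmem : x ∈ FixedPoints.addSubgroup ↥(κ.kerSubgroup ⊓ decomp v) (W.geomPrimaryTorsion p) :=
    (FixedPoints.mem_addSubgroup _ _ x).mpr fun g ↦ hx g g.2
  rw [h] at hmem
  exact (AddSubgroup.mem_bot).mp hmem

/-- **(a) on every ADDITIVE row at `p ≥ 11`** (no local hypothesis; `W` globally minimal).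
[cite: GreenbergLNM1716, §3 Lemma 3.1 (p. 86)] [cite: Mazur1977, Ch. III §5, Step 1 (p. 158)] -/
theorem resOfLe_kerSubgroup_injective_of_addv_of_eleven_le [W.IsGloballyMinimal]
    {H : Subgroup (absoluteGaloisGroup ℚ)} (hle : κ.kerSubgroup ≤ H) (h11 : 11 ≤ p) (hadd : Addv W p)
    (v : HeightOneSpectrum (𝓞 ℚ)) (hv : ((Rat.HeightOneSpectrum.primesEquiv v : Nat.Primes) : ℕ) = p) :
    Injective (W.resOfLe p hle) :=
  resOfLe_kerSubgroup_injective_of_noPTorsionPadic W p κ hle v hv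
    fun _ hR => Additive.eq_zero_of_prime_nsmul_eq_zero_of_addv_of_eleven_le W p h11 hadd hR

/-- **(b) on every ADDITIVE row at `p ≥ 11`** (no local hypothesis; `W` globally minimal).
[cite: GreenbergLNM1716, §3 p. 96 (Prop. 3.8)] [cite: Mazur1977, Ch. III §5, Step 1 (p. 158)] -/
theorem resOfLe_inf_decomp_eq_zero_of_addv_of_eleven_le [W.IsGloballyMinimal] (h11 : 11 ≤ p) (hadd : Addv W p)
    (v : HeightOneSpectrum (𝓞 ℚ)) (hv : ((Rat.HeightOneSpectrum.primesEquiv v : Nat.Primes) : ℕ) = p)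
    {y : W.subgroupH1 p (κ.layerSubgroup 0)}
    (hy : W.resOfLe p (inf_le_left.trans (κ.kerSubgroup_le_layerSubgroup 0) :
      κ.kerSubgroup ⊓ decomp v ≤ κ.layerSubgroup 0) y = 0) :
    W.resOfLe p (inf_le_left : κ.layerSubgroup 0 ⊓ decomp v ≤ κ.layerSubgroup 0) y = 0 :=
  resOfLe_inf_decomp_eq_zero_of_resOfLe_kerSubgroup_inf_decomp_eq_zero W p κ v hv
    (fun _ hR => Additive.eq_zero_of_prime_nsmul_eq_zero_of_addv_of_eleven_le W p h11 hadd hR) hy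

end Rat

end Summit.BirchSwinnertonDyer.BirchSwinnertonDyer.Theorems.TowerFineControl

end
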